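import Summits.QuantumFields.YangMills.Theses.ThermalDescent

/-!
# ThermalDescent — glue of the ElectricSeam split (gen 1)

`SeamFromMoments → FloorUnitMoments → ElectricSeam` (item stmt-QuantumFields-27004, decl `ElectricSeamGlue`):
modus ponens through the shared verbatim `let`-chain of the three statements.  No mathematics.
-/

namespace Summit.QuantumFields.YangMills.Theorems

open Summit.QuantumFields.YangMills.Theses.ThermalDescent in -- route file rev 3 (commit dd28f4ab64e7)
/-- The glue item of the ElectricSeam split: feed `FloorUnitMoments`' `MomentBounds6 G r a` into
`SeamFromMoments`. -/
theorem thermalDescent_electricSeamGlue :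
    Summit.QuantumFields.YangMills.Theses.ThermalDescent.ElectricSeamGlue := by
  intro h1 h2 G _ _ _ _ hG r a ha ha0 St Cfg cc posE P A Ael w E Cov refl B Qrp D Drp v δ₁ δ₂ hδ hsupp hfl η hη
  exact h1 G hG r a ha ha0 (h2 G hG r a ha ha0 v δ₁ δ₂ hδ hsupp hfl) v δ₁ δ₂ hδ hsupp η hη

end Summit.QuantumFields.YangMills.Theorems
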